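import Literature.Geometry.Lorentzian.KerrSchildChartCovariance
import HarnessLib

/-!
# Route ClusterCompleteness · crux `OmegaLimitMultiKerr` — translation identities for boosted-Kerr
# hole charts (deviation at chart time `τ` = size of the `τ`-translate on the time-zero slab)

Structure lemmas for the crux stmt-FinalStateConjecture-14664
(`ClusterCompleteness.OmegaLimitMultiKerr`, rank 9), line `Sketch`, lead gen 3. The recur-disjunct
`Recurs k 𝒟` of the crux (`ClusterCompletenessOmegaLimitMultiKerrDefs`) asks, for each hole chart
`Ψᵢ` on a boosted Kerr background `B = boostedKerrBackground Λ c M a`, that the near-zone `Cᵏ`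
deviation `truncDeviationCk B Ψᵢ k R τ` be `≤ ε` at arbitrarily late chart times `τ`, for every `ε`
and `R`.
The LaSalle / ω-limit reading of the line (idea card `lasalle-lands-on-liminf`) studies instead the
TRANSLATES `x ↦ (Ψᵢ^* g − g_{M,a})(x + τ Λ∂₀)` of the deviation field along the Killing translation
`x ↦ x + s Λ∂₀` of the background (`t* ↦ t* + s`, `r` and `g_{M,a}` invariant:
`KerrSchildChart.time_add_smul / radius_add_smul / boostedKerrBilin_add_smul`). This file is the
dictionary between the two, stated first over an arbitrary `ModelBackground` `B` with a translation
vector `e` (domain `e`-invariant, `t(x + s e) = t(x) + s`, `r(x + s e) = r(x)` — the hypotheses of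
the line's ω-limit compactness lemmas) and then specialised to boosted Kerr:

* `supCkENorm_comp_add_right` — `‖f (· + v)‖_{Cᵏ(S)} = ‖f‖_{Cᵏ(S + v)}`
  (`iteratedFDeriv_comp_add_right`);
* `image_add_smul_image_val` and `image_add_smul_truncTimeSlab / _timeSlab / _truncLateRegion /
  _lateRegion` — the translation by `s e` carries the (truncated) slab at time `σ` onto the one at
  time `σ + s` and the (truncated) late region after `τ₁` onto the one after `τ₁ + s`;
* `truncDeviationCk_add_eq_supCkENorm_translate`, `deviationCk_add_eq_supCkENorm_translate`,
  `supCkENorm_truncLateRegion_add_eq_translate` — the `Cᵏ` deviation on the slab at time `σ + s` is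
  the `Cᵏ` sup norm over the slab at time `σ` of the `s`-translate of the deviation field;
* `add_smul_mem_boostedKerrExterior_iff`, `add_smul_mem_boostedKerrBackground_domain` — the boosted
  exterior is invariant under `x ↦ x + s Λ∂₀`;
* `truncDeviationCk_eq_supCkENorm_translate` (the registered stub, closed form) — for a hole chart
  on `boostedKerrBackground Λ c M a` the truncated `Cᵏ` deviation at chart time `τ` IS the `Cᵏ` sup
  norm over the time-ZERO truncated slab of the `τ`-translate `x ↦ (Ψ^* g − g_{M,a})(x + τ Λ∂₀)`;
  `deviationCk_eq_supCkENorm_translate` — the same for full slabs;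
* `contDiffOn_deviationExtend_boostedKerr` — the extended deviation of a smooth hole chart is `C^∞`
  on the boosted exterior (the regularity input of the `Cᵏ` Arzelà–Ascoli step
  `exists_strictMono_tendsto_supCkENorm_translate_sub`).

Everything is proved; Mathlib + `Literature` only.
-/

-- every `Summit.FinalStateConjecture.FinalStateConjecture.…` name repeats the summit = sub-problem segment (D-0017 layout)
set_option linter.dupNamespace false

noncomputable section

open scoped Manifold ContDiff Topology ENNReal
open Set Filter TopologicalSpace

namespace Summit.FinalStateConjecture.FinalStateConjecture.Theorems.ClusterCompleteness

open Literature.Geometry.Lorentzian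

/-! ### `Cᵏ` sup norms of translates -/

section SupNorm

variable {E W : Type*} [NormedAddCommGroup E] [NormedSpace ℝ E] [NormedAddCommGroup W]
  [NormedSpace ℝ W]

/-- **The `Cᵏ` sup norm of a translate is the `Cᵏ` sup norm over the translated set**:
`‖f (· + v)‖_{Cᵏ(S)} = ‖f‖_{Cᵏ(S + v)}` (translation commutes with `iteratedFDeriv`,
`iteratedFDeriv_comp_add_right`; Bartnik 1986, (1.3) for the norm). [folklore] -/
theorem supCkENorm_comp_add_right (S : Set E) (k : ℕ) (f : E → W) (v : E) :
    supCkENorm S k (fun x ↦ f (x + v)) = supCkENorm ((fun x ↦ x + v) '' S) k f := by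
  simp only [supCkENorm, iteratedFDeriv_comp_add_right, iSup_image]

end SupNorm

/-! ### Backgrounds with a translation vector: transport of slabs and late regions -/

section Translation

variable (B : ModelBackground) (e : E4)
  (hdom : ∀ x ∈ (B.domain : Set E4), ∀ s : ℝ, x + s • e ∈ (B.domain : Set E4))
  (htime : ∀ (x : E4) (s : ℝ), B.time (x + s • e) = B.time x + s)
  (hrad : ∀ (x : E4) (s : ℝ), B.radius (x + s • e) = B.radius x)

include hdom in
/-- **Transport of subsets of the domain along a translation preserving it**: if the domain `U` of
`B` is invariant under `x ↦ x + s e` (all `s`) and membership of `x` in `S ⊆ U` is membership of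
`x + s e` in `T ⊆ U`, then the translate by `s e` of `S`, as a subset of `E4`, is `T`. [folklore] -/
theorem image_add_smul_image_val {s : ℝ} {S T : Set B.domain}
    (hST : ∀ (x : E4) (hx : x ∈ (B.domain : Set E4)) (hx' : x + s • e ∈ (B.domain : Set E4)),
      (⟨x, hx⟩ : B.domain) ∈ S ↔ (⟨x + s • e, hx'⟩ : B.domain) ∈ T) :
    (fun x : E4 ↦ x + s • e) '' (Subtype.val '' S) = Subtype.val '' T := by
  ext y
  constructor
  · rintro ⟨_, ⟨x, hxS, rfl⟩, rfl⟩
    have hx' : x.1 + s • e ∈ (B.domain : Set E4) := hdom x.1 x.2 s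
    exact ⟨⟨_, hx'⟩, (hST x.1 x.2 hx').1 hxS, rfl⟩
  · rintro ⟨x, hxT, rfl⟩
    have hx' : x.1 + (-s) • e ∈ (B.domain : Set E4) := hdom x.1 x.2 (-s)
    have hback : x.1 + (-s) • e + s • e = x.1 := by
      rw [neg_smul, neg_add_cancel_right]
    have hx'' : x.1 + (-s) • e + s • e ∈ (B.domain : Set E4) := by
      rw [hback]
      exact x.2
    have hxe : (⟨_, hx''⟩ : B.domain) = x := Subtype.ext hback
    refine ⟨_, ⟨⟨_, hx'⟩, (hST _ hx' hx'').2 ?_, rfl⟩, hback⟩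
    rw [hxe]
    exact hxT

include hdom htime hrad in
/-- **The translation by `s e` carries the truncated slab `{t = σ, r ≤ R}` onto the truncated slab
`{t = σ + s, r ≤ R}`** (as subsets of `E4`; DHRT arXiv:2104.08222, §1 for the slabs). [folklore] -/
theorem image_add_smul_truncTimeSlab (R σ s : ℝ) :
    (fun x : E4 ↦ x + s • e) '' (Subtype.val '' B.truncTimeSlab R σ) =
      Subtype.val '' B.truncTimeSlab R (σ + s) := by
  refine image_add_smul_image_val B e hdom fun x hx hx' ↦ ?_
  simp only [ModelBackground.mem_truncTimeSlab, htime, hrad, add_left_inj]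

include hdom htime in
/-- The translation by `s e` carries the slab `{t = σ}` onto the slab `{t = σ + s}`. [folklore] -/
theorem image_add_smul_timeSlab (σ s : ℝ) :
    (fun x : E4 ↦ x + s • e) '' (Subtype.val '' B.timeSlab σ) =
      Subtype.val '' B.timeSlab (σ + s) := by
  refine image_add_smul_image_val B e hdom fun x hx hx' ↦ ?_
  simp only [ModelBackground.mem_timeSlab, htime, add_left_inj]

include hdom htime hrad in
/-- The translation by `s e` carries the truncated late region `{t > τ₁, r ≤ R}` onto the truncated
late region `{t > τ₁ + s, r ≤ R}`. [folklore] -/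
theorem image_add_smul_truncLateRegion (τ₁ R s : ℝ) :
    (fun x : E4 ↦ x + s • e) '' (Subtype.val '' B.truncLateRegion τ₁ R) =
      Subtype.val '' B.truncLateRegion (τ₁ + s) R := by
  refine image_add_smul_image_val B e hdom fun x hx hx' ↦ ?_
  simp only [ModelBackground.mem_truncLateRegion, htime, hrad, add_lt_add_iff_right]

include hdom htime in
/-- The translation by `s e` carries the late region `{t > τ₀}` onto the late region `{t > τ₀ + s}`.
[folklore] -/
theorem image_add_smul_lateRegion (τ₀ s : ℝ) :
    (fun x : E4 ↦ x + s • e) '' (Subtype.val '' B.lateRegion τ₀) =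
      Subtype.val '' B.lateRegion (τ₀ + s) := by
  refine image_add_smul_image_val B e hdom fun x hx hx' ↦ ?_
  simp only [ModelBackground.mem_lateRegion, htime, add_lt_add_iff_right]

include hdom htime hrad in
/-- **The truncated `Cᵏ` deviation on the slab at time `σ + s` is the `Cᵏ` sup norm, over the
truncated slab at time `σ`, of the `s`-translate `x ↦ (Ψ^* g − g₀)(x + s e)` of the deviation
field** (DHRT arXiv:2104.08222, §1 for the deviation; translation commutes with derivatives).
[folklore] -/
theorem truncDeviationCk_add_eq_supCkENorm_translate (𝓢 : Spacetime 4)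
    (Ψ : B.domain → 𝓢.carrier) (k : ℕ) (R σ s : ℝ) :
    𝓢.truncDeviationCk B Ψ k R (σ + s) =
      supCkENorm (Subtype.val '' B.truncTimeSlab R σ) k
        (fun x ↦ 𝓢.deviationExtend B Ψ (x + s • e)) := by
  rw [supCkENorm_comp_add_right, image_add_smul_truncTimeSlab B e hdom htime hrad]
  rfl

include hdom htime in
/-- The full `Cᵏ` deviation on the slab `{t = σ + s}` is the `Cᵏ` sup norm over the slab `{t = σ}`
of the `s`-translate of the deviation field. [folklore] -/
theorem deviationCk_add_eq_supCkENorm_translate (𝓢 : Spacetime 4)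
    (Ψ : B.domain → 𝓢.carrier) (k : ℕ) (σ s : ℝ) :
    𝓢.deviationCk B Ψ k (σ + s) =
      supCkENorm (Subtype.val '' B.timeSlab σ) k (fun x ↦ 𝓢.deviationExtend B Ψ (x + s • e)) := by
  rw [supCkENorm_comp_add_right, image_add_smul_timeSlab B e hdom htime]
  rfl

include hdom htime hrad in
/-- The `Cᵏ` sup norm of a field over the truncated late region `{t > τ₁ + s, r ≤ R}` is the `Cᵏ`
sup norm over `{t > τ₁, r ≤ R}` of its `s`-translate. [folklore] -/
theorem supCkENorm_truncLateRegion_add_eq_translate {W : Type*} [NormedAddCommGroup W]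
    [NormedSpace ℝ W] (f : E4 → W) (k : ℕ) (τ₁ R s : ℝ) :
    supCkENorm (Subtype.val '' B.truncLateRegion (τ₁ + s) R) k f =
      supCkENorm (Subtype.val '' B.truncLateRegion τ₁ R) k (fun x ↦ f (x + s • e)) := by
  rw [supCkENorm_comp_add_right, image_add_smul_truncLateRegion B e hdom htime hrad]

end Translation

/-! ### Boosted Kerr: the Killing translation `x ↦ x + s Λ∂₀` -/

section Boosted

variable (Λ : lorentzGroup) (c : E4) (M a : ℝ)

/-- **The boosted Kerr exterior is invariant under the Killing translation** `x ↦ x + s Λ∂₀`: the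
rest-frame radius `r(Λ⁻¹(x − c))` is (`KerrSchildChart.radius_add_smul`), and the exterior is
`{max r₊ 0 < r}` (Kerr–Schild 1965, §2: `∂_{t*}` is Killing). [folklore] -/
theorem add_smul_mem_boostedKerrExterior_iff (x : E4) (s : ℝ) :
    x + s • (Λ : E4 ≃L[ℝ] E4) (EuclideanSpace.single (0 : Fin 4) (1 : ℝ)) ∈
        boostedKerrExterior Λ c M a ↔ x ∈ boostedKerrExterior Λ c M a := by
  have h : Kerr.radius a (poincareInv Λ c
      (x + s • (Λ : E4 ≃L[ℝ] E4) (EuclideanSpace.single (0 : Fin 4) (1 : ℝ)))) =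
      Kerr.radius a (poincareInv Λ c x) :=
    KerrSchildChart.radius_add_smul Λ c M a x s
  rw [mem_boostedKerrExterior, mem_boostedKerrExterior, Kerr.mem_exterior, Kerr.mem_exterior, h]

/-- The domain of `boostedKerrBackground Λ c M a` is invariant under all Killing translations
`x ↦ x + s Λ∂₀`, `s ∈ ℝ` (the invariance hypothesis of the line's ω-limit compactness lemmas).
[folklore] -/
theorem add_smul_mem_boostedKerrBackground_domain :
    ∀ x ∈ ((boostedKerrBackground Λ c M a).domain : Set E4), ∀ s : ℝ,
      x + s • (Λ : E4 ≃L[ℝ] E4) (EuclideanSpace.single (0 : Fin 4) (1 : ℝ)) ∈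
        ((boostedKerrBackground Λ c M a).domain : Set E4) :=
  fun x hx s ↦ (add_smul_mem_boostedKerrExterior_iff Λ c M a x s).2 hx

/-- **Registered structure stub (crux stmt-FinalStateConjecture-14664, line `Sketch`).** For a hole
chart `Ψ` on `boostedKerrBackground Λ c M a`, the truncated `Cᵏ` deviation at chart time `τ` IS the
`Cᵏ` sup norm over the time-ZERO truncated slab `{t* = 0, r ≤ R}` of the `τ`-translate
`x ↦ (Ψ^* g − g_{M,a})(x + τ Λ∂₀)` of the deviation field: the Killing translation carries
`{t* = 0, r ≤ R}` onto `{t* = τ, r ≤ R}` (`KerrSchildChart.time_add_smul / radius_add_smul`) and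
commutes with derivatives. This turns the recurrence clause of `Recurs k 𝒟` into a statement about
ω-limits of translates (Hale 1980, Ch. I, §8). Closed form. [folklore] -/
theorem truncDeviationCk_eq_supCkENorm_translate :
    ∀ (𝓢 : Spacetime 4) (Λ : lorentzGroup) (c : E4) (M a : ℝ)
      (Ψ : (boostedKerrBackground Λ c M a).domain → 𝓢.carrier) (k : ℕ) (R τ : ℝ),
      𝓢.truncDeviationCk (boostedKerrBackground Λ c M a) Ψ k R τ =
        supCkENorm (Subtype.val '' (boostedKerrBackground Λ c M a).truncTimeSlab R 0) k
          (fun x ↦ 𝓢.deviationExtend (boostedKerrBackground Λ c M a) Ψ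
            (x + τ • (Λ : E4 ≃L[ℝ] E4) (EuclideanSpace.single (0 : Fin 4) (1 : ℝ)))) := by
  intro 𝓢 Λ c M a Ψ k R τ
  rw [← truncDeviationCk_add_eq_supCkENorm_translate _ _
    (add_smul_mem_boostedKerrBackground_domain Λ c M a) (KerrSchildChart.time_add_smul Λ c M a)
    (KerrSchildChart.radius_add_smul Λ c M a) 𝓢 Ψ k R 0 τ, zero_add]

/-- For a hole chart `Ψ` on `boostedKerrBackground Λ c M a`, the full `Cᵏ` deviation at chart time
`τ` is the `Cᵏ` sup norm over the time-zero slab `{t* = 0}` of the `τ`-translate of the deviation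
field. [folklore] -/
theorem deviationCk_eq_supCkENorm_translate (𝓢 : Spacetime 4)
    (Ψ : (boostedKerrBackground Λ c M a).domain → 𝓢.carrier) (k : ℕ) (τ : ℝ) :
    𝓢.deviationCk (boostedKerrBackground Λ c M a) Ψ k τ =
      supCkENorm (Subtype.val '' (boostedKerrBackground Λ c M a).timeSlab 0) k
        (fun x ↦ 𝓢.deviationExtend (boostedKerrBackground Λ c M a) Ψ
          (x + τ • (Λ : E4 ≃L[ℝ] E4) (EuclideanSpace.single (0 : Fin 4) (1 : ℝ)))) := by
  rw [← deviationCk_add_eq_supCkENorm_translate _ _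
    (add_smul_mem_boostedKerrBackground_domain Λ c M a) (KerrSchildChart.time_add_smul Λ c M a)
    𝓢 Ψ k 0 τ, zero_add]

/-- For a hole chart on `boostedKerrBackground Λ c M a`, the truncated `Cᵏ` deviation at chart time
`σ + s` is the `Cᵏ` sup norm over the truncated slab at time `σ` of the `s`-translate of the
deviation field (flow law of the translates). [folklore] -/
theorem truncDeviationCk_add_eq_supCkENorm_translate_boostedKerr (𝓢 : Spacetime 4)
    (Ψ : (boostedKerrBackground Λ c M a).domain → 𝓢.carrier) (k : ℕ) (R σ s : ℝ) :
    𝓢.truncDeviationCk (boostedKerrBackground Λ c M a) Ψ k R (σ + s) =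
      supCkENorm (Subtype.val '' (boostedKerrBackground Λ c M a).truncTimeSlab R σ) k
        (fun x ↦ 𝓢.deviationExtend (boostedKerrBackground Λ c M a) Ψ
          (x + s • (Λ : E4 ≃L[ℝ] E4) (EuclideanSpace.single (0 : Fin 4) (1 : ℝ)))) :=
  truncDeviationCk_add_eq_supCkENorm_translate _ _
    (add_smul_mem_boostedKerrBackground_domain Λ c M a) (KerrSchildChart.time_add_smul Λ c M a)
    (KerrSchildChart.radius_add_smul Λ c M a) 𝓢 Ψ k R σ s

/-- **The extended deviation `Ψ^* g − g_{M,a}` of a smooth hole chart is `C^∞` on the boosted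
exterior**: `Ψ^* g` has smooth components there (`KerrSchildChart.contDiffAt_chartMetric`, O'Neill
1983, Ch. 3, Lemma 3.35) and so does the boosted Kerr–Schild form
(`KerrSchildChart.contDiffAt_boostedKerrBilin`). [folklore] -/
theorem contDiffOn_deviationExtend_boostedKerr (𝓢 : Spacetime 4) {Λ : lorentzGroup} {c : E4}
    {M a : ℝ} {Ψ : (boostedKerrBackground Λ c M a).domain → 𝓢.carrier}
    (hΨ : ContMDiff 𝓘(ℝ, E4) (𝓡 4) ∞ Ψ) :
    ContDiffOn ℝ ∞ (𝓢.deviationExtend (boostedKerrBackground Λ c M a) Ψ)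
      (boostedKerrExterior Λ c M a : Set E4) := by
  intro z hz
  have hsmooth : ContDiffAt ℝ ∞ (fun z ↦ 𝓢.deviationExtend (boostedKerrBackground Λ c M a) Ψ z +
      boostedKerrBilin Λ c M a z) z :=
    KerrSchildChart.contDiffAt_chartMetric hΨ (KerrSchildChart.chartMetric_repr Λ c M a Ψ) ⟨z, hz⟩
  have hfun : (fun y ↦ (fun z ↦ 𝓢.deviationExtend (boostedKerrBackground Λ c M a) Ψ z +
      boostedKerrBilin Λ c M a z) y - boostedKerrBilin Λ c M a y) =
      𝓢.deviationExtend (boostedKerrBackground Λ c M a) Ψ := by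
    funext y
    exact add_sub_cancel_right (𝓢.deviationExtend (boostedKerrBackground Λ c M a) Ψ y) _
  have hdev : ContDiffAt ℝ ∞ (𝓢.deviationExtend (boostedKerrBackground Λ c M a) Ψ) z := by
    rw [← hfun]
    exact hsmooth.sub (KerrSchildChart.contDiffAt_boostedKerrBilin Λ c M a hz)
  exact hdev.contDiffWithinAt

end Boosted

end Summit.FinalStateConjecture.FinalStateConjecture.Theorems.ClusterCompleteness

end
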